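import Summits.QuantumFields.YangMills.Theorems.LuscherReductionTwistedTraceScalingGaugeSliceKernel
import Summits.QuantumFields.YangMills.Theorems.LuscherReductionTwistedTraceScalingGaugeSlice
import Summits.QuantumFields.YangMills.Theorems.LuscherReductionRunningReductionAxialGauge
import HarnessLib

/-!
# (A1 tool) A GAUGE-INVARIANT SLOW WEIGHT DOES NOT SEE THE GAUGE AVERAGE: `∫ K̃_β(U,V)·f(V) dV = ∫ K_β(U,V)·f(V) dV` and `∫ K_β(U^g,V)·f(V) dV = ∫ K_β(U,V)·f(V) dV`
# for gauge-invariant bounded measurable `f` — the `c`-uniformity of the slow moment integrals in the assembly (A1) of `stub_hODpot_A`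
# (memo `Cruxes/NearFlatRatioLaw/Lines/ratepack-v7-moments-g18.md` §5 (A1); route `FlatTubeReduction`, crux K1 `NearFlatRatioLaw` stmt-QuantumFields-24720, line «ratepack_v2» skeleton v6;
# seat `ym-line-ftr-p1` g18; R2b1 RECORD rung — no summit statement is proved here)

WHY.  In the Cauchy–Schwarz form of the core-transfer defect (`…CoreTransferMomentsCS`) the colour-averaged moments are `∫_c ρ_c(u',u)·T[m](c⁻¹(oT 1 x')c) dc` with
`ρ_c(u',u) = K₁(c⁻¹u'c, u)/K₁(1,1)`; the slow coefficients `γ_m(u',u)²` are polynomials in `orbitDist u` and the one-site actions, hence GAUGE INVARIANT in `u` (on the one-site lattice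
every gauge transformation is a constant conjugation).  Integrating `u` first, `∫_u γ²(u',u)·K₁(c⁻¹u'c,u) du = ∫_u γ²(u',u)·K₁(u',u) du` for EVERY `c` (this file, from the tree's
`transferPotential_gaugeTransform`), so the colour integral factorises: `∫_u γ² Y_m du = (∫_u γ²K₁(u',·)/K₁(1,1))·∫_c T[m](c⁻¹(oT 1 x')c) dc`, and the gauge-AVERAGED form
`∫_u γ²·K̃₁(u',u) du` (to which ✓(ρ2) `…OneSiteKernelOrbitMoment` applies) is the same number.
* the tree's `transferPotential_gaugeTransform` — `∫ K_β(U^g,V)f(V) dV = ∫ K_β(U,V)f(V) dV` (gauge-invariant `f`) is used for every `c` (no restatement);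
* ★ `integral_avgKernel_mul_eq` — `∫ K̃_β(U,V)·f(V) dV = ∫ K_β(U,V)·f(V) dV` (Fubini over the gauge group + the previous line).
HONEST FRAMING: measure-theoretic bookkeeping for a stub of the CONDITIONAL reduction route R2b1 (rate twin); femto rung R2b1 (RECORD label); not infinite volume, not a mass gap,
not Clay.  No defs, no named facts, no `sorry`.
-/

set_option autoImplicit false

noncomputable section

open MeasureTheory Filter Topology Real
open scoped BigOperators
open Literature.MathematicalPhysics.QuantumFieldTheory
open Literature.MathematicalPhysics.QuantumLattice

namespace Summit.QuantumFields.YangMills.Theorems.FemtoTransferGap.TwoLattice.ConstTube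

open Summit.QuantumFields.YangMills.Theorems.FemtoTransferGap
open Summit.QuantumFields.YangMills.Theorems.FemtoTransferGap.TwoLattice
open Summit.QuantumFields.YangMills.Theorems.FemtoTransferGap.TwoLattice.Avg

variable {L : ℕ} [NeZero L]

/-- ★ **A gauge-invariant weight does not see the gauge average**: `∫ K̃_β(U,V)·f(V) dV = ∫ K_β(U,V)·f(V) dV` for gauge-invariant bounded measurable `f`. [cite: SeilerLNP1982, §3] -/
theorem integral_avgKernel_mul_eq (β : ℝ) {f : GaugeConfig 3 L SU2 → ℝ} (hfm : Measurable f) {Cf : ℝ} (hCf : ∀ V, |f V| ≤ Cf)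
    (hfg : ∀ (g : Site 3 L → SU2) (U : GaugeConfig 3 L SU2), f (gaugeTransform g U) = f U) (U : GaugeConfig 3 L SU2) :
    ∫ V, avgKernel β U V * f V ∂configMeasure SU2 L = ∫ V, transferKernel su2Rep β U V * f V ∂configMeasure SU2 L := by
  haveI : SecondCountableTopology SU2 := secondCountableTopology_su2
  obtain ⟨M, hM⟩ := exists_transferKernel_le su2Rep continuous_su2Rep β (L := L)
  have hCf0 : 0 ≤ Cf := (abs_nonneg _).trans (hCf 1)
  have hM0 : 0 ≤ M := (transferKernel_pos su2Rep β (1 : GaugeConfig 3 L SU2) 1).le.trans (hM 1 1)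
  -- the joint integrand `(V, g) ↦ K(U, V^g)·f(V)`
  have hK : Measurable fun p : GaugeConfig 3 L SU2 × GaugeConfig 3 L SU2 => transferKernel su2Rep β p.1 p.2 := measurable_transferKernel_lat β
  have hjm : Measurable fun p : GaugeConfig 3 L SU2 × (Site 3 L → SU2) => transferKernel su2Rep β U (gaugeTransform p.2 p.1) * f p.1 := by
    have ha : Measurable fun p : GaugeConfig 3 L SU2 × (Site 3 L → SU2) => (gaugeTransform p.2 p.1) := by
      have h := (measurable_gaugeAction (L := L)).comp (measurable_fst.prodMk measurable_snd : Measurable fun p : GaugeConfig 3 L SU2 × (Site 3 L → SU2) => (p.1, p.2))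
      simpa only [Function.comp_def] using h
    have hc : Measurable fun _ : GaugeConfig 3 L SU2 × (Site 3 L → SU2) => U := measurable_const
    have h := hK.comp (hc.prodMk ha)
    exact (by simpa only [Function.comp_def] using h : Measurable fun p : GaugeConfig 3 L SU2 × (Site 3 L → SU2) => transferKernel su2Rep β U (gaugeTransform p.2 p.1)).mul
      (hfm.comp measurable_fst)
  have hjb : ∀ p : GaugeConfig 3 L SU2 × (Site 3 L → SU2), |transferKernel su2Rep β U (gaugeTransform p.2 p.1) * f p.1| ≤ M * Cf := fun p => by
    rw [abs_mul, abs_of_pos (transferKernel_pos su2Rep β _ _)]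
    exact mul_le_mul (hM _ _) (hCf _) (abs_nonneg _) hM0
  have hjint : Integrable (fun p : GaugeConfig 3 L SU2 × (Site 3 L → SU2) => transferKernel su2Rep β U (gaugeTransform p.2 p.1) * f p.1)
      ((configMeasure SU2 L).prod (gaugeMeasure L)) := integrable_of_measurable_abs_le _ hjm hjb
  -- `∫_V K̃(U,V) f(V) = ∫_V ∫_g K(U,V^g) f(V) = ∫_g ∫_V K(U,V^g) f(V) = ∫_g ∫_V K(U,V) f(V)`
  have h1 : ∫ V, avgKernel β U V * f V ∂configMeasure SU2 L = ∫ V, ∫ g, transferKernel su2Rep β U (gaugeTransform g V) * f V ∂gaugeMeasure L ∂configMeasure SU2 L := by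
    refine integral_congr_ae (ae_of_all _ fun V => ?_)
    dsimp only
    unfold avgKernel
    rw [integral_mul_const]
  rw [h1, integral_integral_swap hjint]
  have h2 : ∀ g : Site 3 L → SU2, ∫ V, transferKernel su2Rep β U (gaugeTransform g V) * f V ∂configMeasure SU2 L = ∫ V, transferKernel su2Rep β U V * f V ∂configMeasure SU2 L := by
    intro g
    have e : ∀ V, transferKernel su2Rep β U (gaugeTransform g V) = transferKernel su2Rep β (gaugeTransform g⁻¹ U) V := fun V => by
      rw [transferKernel_gaugeTransform_right_eq, transferKernel_su2Rep_symm]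
    simp_rw [e]
    exact transferPotential_gaugeTransform β hfm hfg g⁻¹ U
  simp_rw [h2]
  rw [integral_const, smul_eq_mul, probReal_univ, one_mul]

end Summit.QuantumFields.YangMills.Theorems.FemtoTransferGap.TwoLattice.ConstTube

end
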